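import Mathlib.AlgebraicGeometry.EllipticCurve.Affine.Point
import Mathlib.Analysis.Complex.Basic
import Mathlib.LinearAlgebra.Dimension.Finrank
import Mathlib.FieldTheory.IsAlgClosed.Basic
import Mathlib.Analysis.Complex.Polynomial.Basic
import HarnessLib

/-!
# The zeta function of an elliptic curve over a finite field (Hasse–Weil; Silverman V.2.3.1)

Topic `NumberTheory/EllipticCurves`. Vendored for the provefact decomposition of
`Literature.NumberTheory.EllipticCurves.FunctionField.hasLContinuation` (Ulmer 2011, Lecture 1, Exercise 9.2: the `L`-function of a
*constant* elliptic curve `E₀ ×_k K` over a global function field is computed from the zeta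
functions of `E₀` and of the base curve), where the zeta function of `E₀ / 𝔽_q` enters through
the point counts `#E₀(𝔽_{qⁿ}) = qⁿ + 1 - αⁿ - βⁿ`.

For an elliptic curve `E` over the finite field `k = 𝔽_q` given by a Weierstrass curve `W`, let
`a = q + 1 - #E(𝔽_q)` (the trace of Frobenius) and let `α, β ∈ ℂ` be the roots of `T² - aT + q`.
**Silverman, *AEC*, Thm. V.2.3.1(a)**: `α` and `β` are complex conjugates with
`|α| = |β| = √q`, and `#E(𝔽_{qⁿ}) = qⁿ + 1 - αⁿ - βⁿ` for every `n ≥ 1`. Equivalently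
(Thm. V.2.4) `Z(E/𝔽_q; T) = (1 - αT)(1 - βT) / ((1 - T)(1 - qT))`, i.e.
`ζ(E, s) = (1 - α q^{-s})(1 - β q^{-s}) / ((1 - q^{-s})(1 - q^{1-s}))`, the form used by Ulmer
(2011), Lecture 0, §3 and Lecture 1, Exercise 9.2.

We record Thm. V.2.3.1(a) as the named fact `WeierstrassCurve.card_point_baseChange_eq W`
(a `def … : Prop`, D-0014; not discharged here). "The roots of `T² - aT + q`" is transcribed by
Vieta (`α + β = a`, `αβ = q`, equivalent over `ℂ` to `T² - aT + q = (T - α)(T - β)`), and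
"`#E(𝔽_{qⁿ})`, `n ≥ 1`" by the number of points (Mathlib's `WeierstrassCurve.Affine.Point`, the
affine points together with `O`, counted with `Nat.card`) of the base change `W.baseChange K` to an
arbitrary finite extension field `K ⊇ k`, with `n = [K : k] = Module.finrank k K` (every finite
extension of `𝔽_q` of degree `n` is `𝔽_{qⁿ}`, and `n ≥ 1` automatically).

## Mathlib / Literature search

Mathlib (pin v4.32.0) has `WeierstrassCurve.Affine.Point`, `baseChange`, `IsElliptic`,
`FiniteField.frobenius…`, `GaloisField`, but no point-count formula for elliptic curves over
finite fields and no zeta function of a curve (grep `q ^ n + 1`, `Hasse`, `zeta` in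
`AlgebraicGeometry/EllipticCurve`: nothing). In Literature,
`Literature.NumberTheory.EllipticCurves.HasseManin` *proves* Hasse's bound `|a| ≤ 2√q`
(Thm. V.1.1) for every elliptic curve over every finite field, and
`Literature.NumberTheory.EllipticCurves.FrobeniusTateModule` vendors the Tate-module form of the
*proof* of Thm. V.2.3.1 (`tr φ_ℓ = a`, `det φ_ℓ = q`, named facts) and derives V.2.3.1(b) on
`T_ℓ E`; neither states the point counts over the extensions `𝔽_{qⁿ}`, which is what the
function-field `L`-function needs. Nothing here duplicates them.

## Design notes

* `namespace WeierstrassCurve` (deliberate dot-notation extension of the Mathlib namespace, as in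
  `FrobeniusTateModule`): `W.card_point_baseChange_eq`.
* Universe-monomorphic (`k K : Type`), matching the consumer
  (`Literature.NumberTheory.EllipticCurves.FunctionFieldEllipticL`, where `F : Type` is forced).
* `q = Fintype.card k` and `a ∈ ℤ` are written out; the identity is stated in `ℂ` (where `α, β`
  live), with `n = Module.finrank k K`.

## References

* [SilvermanAEC2009] J. H. Silverman, *The Arithmetic of Elliptic Curves*, 2nd ed., GTM 106,
  Springer 2009, Thm. V.2.3.1 and Thm. V.2.4 (p. 142–143).
* [Ulmer2011ParkCity] D. Ulmer, *Elliptic curves over function fields*, IAS/Park City Math.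
  Ser. 18 (2011), Lecture 0, §3 and Lecture 1, Exercise 9.2 (arXiv:1101.1939).
* H. Hasse, *Zur Theorie der abstrakten elliptischen Funktionenkörper III*, J. reine angew.
  Math. 175 (1936); A. Weil, *Numbers of solutions of equations in finite fields*, Bull. AMS 55
  (1949).
-/

noncomputable section

namespace WeierstrassCurve

variable {k : Type} [Field k] [Fintype k] (W : WeierstrassCurve k)

/-- **Hasse–Weil for elliptic curves over finite fields** (Silverman, *AEC*, Thm. V.2.3.1(a)).
Let `E / 𝔽_q` be an elliptic curve (`W` elliptic over the finite field `k`, `q = #k`), let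
`a = q + 1 - #E(𝔽_q)` and let `α, β ∈ ℂ` be the roots of `T² - aT + q` (i.e. `α + β = a` and
`αβ = q`). Then `α` and `β` are complex conjugates satisfying `|α| = |β| = √q`, and for every
`n ≥ 1`, `#E(𝔽_{qⁿ}) = qⁿ + 1 - αⁿ - βⁿ`; here `𝔽_{qⁿ}` is any finite extension field `K` of `k`,
`n = [K : k]`, and `#E(K)` is the number of points of `W.baseChange K` (affine points and `O`).
Equivalently `Z(E/𝔽_q; T) = (1 - αT)(1 - βT)/((1 - T)(1 - qT))` (Thm. V.2.4).
A named fact (not discharged in Literature). [cite: SilvermanAEC2009, Thm. V.2.3.1(a)] -/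
def card_point_baseChange_eq : Prop :=
  ∀ [W.IsElliptic] (α β : ℂ),
    α + β = (((Fintype.card k : ℤ) + 1 - (Nat.card W.toAffine.Point : ℤ) : ℤ) : ℂ) →
    α * β = (Fintype.card k : ℂ) →
      starRingEnd ℂ α = β ∧ ‖α‖ = √(Fintype.card k : ℝ) ∧ ‖β‖ = √(Fintype.card k : ℝ) ∧
        ∀ (K : Type) [Field K] [Fintype K] [Algebra k K],
          (Nat.card (W.baseChange K).toAffine.Point : ℂ) =
            (Fintype.card k : ℂ) ^ Module.finrank k K + 1
              - α ^ Module.finrank k K - β ^ Module.finrank k K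

/-- Existence form of `card_point_baseChange_eq`: the quadratic `T² - aT + q` has roots
`α, β ∈ ℂ` (`ℂ` is algebraically closed; `α, β = (a ± δ)/2` with `δ² = a² - 4q`), so the named
fact yields Frobenius roots with `α + β = a`, `αβ = q`, `|α| = |β| = √q` and the point counts
`#E(K) = q^[K:k] + 1 - α^[K:k] - β^[K:k]` over every finite extension `K / k`. This is the form
consumed by `Literature.NumberTheory.EllipticCurves.FunctionFieldEllipticLRationality`.
Relies on: hypothesis `h` (the named fact, at this `W`). [cite: SilvermanAEC2009, Thm. V.2.3.1(a)] -/
theorem card_point_baseChange_eq.exists_roots [W.IsElliptic] (h : W.card_point_baseChange_eq) :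
    ∃ α β : ℂ,
      α + β = (((Fintype.card k : ℤ) + 1 - (Nat.card W.toAffine.Point : ℤ) : ℤ) : ℂ) ∧
      α * β = (Fintype.card k : ℂ) ∧
      ‖α‖ = √(Fintype.card k : ℝ) ∧ ‖β‖ = √(Fintype.card k : ℝ) ∧
      ∀ (K : Type) [Field K] [Fintype K] [Algebra k K],
        (Nat.card (W.baseChange K).toAffine.Point : ℂ) =
          (Fintype.card k : ℂ) ^ Module.finrank k K + 1
            - α ^ Module.finrank k K - β ^ Module.finrank k K := by
  set a : ℂ := (((Fintype.card k : ℤ) + 1 - (Nat.card W.toAffine.Point : ℤ) : ℤ) : ℂ) with ha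
  set q : ℂ := (Fintype.card k : ℂ) with hq
  obtain ⟨δ, hδ⟩ := IsAlgClosed.exists_eq_mul_self (a ^ 2 - 4 * q)
  refine ⟨(a + δ) / 2, (a - δ) / 2, by ring, ?_, ?_⟩
  · linear_combination ((1 : ℂ) / 4) * hδ
  · have hsum : (a + δ) / 2 + (a - δ) / 2 = a := by ring
    have hprod : (a + δ) / 2 * ((a - δ) / 2) = q := by
      linear_combination ((1 : ℂ) / 4) * hδ
    obtain ⟨-, h₁, h₂, h₃⟩ := h _ _ hsum hprod
    exact ⟨h₁, h₂, fun K _ _ _ => h₃ K⟩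

end WeierstrassCurve

end
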